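import Literature.NumberTheory.LFunctions.Zhang2022.RepairTopFormIndefinite
import Literature.NumberTheory.LFunctions.Zhang2022.DetectorRecipeMoments
import Literature.NumberTheory.LFunctions.Zhang2022.MainTermFormEllPolar
import Literature.NumberTheory.LFunctions.Zhang2022.ObjectiveTwinEllKernelForm
import Literature.NumberTheory.LFunctions.Zhang2022.DetectorShiftAdmissible
import HarnessLib

/-!
# `F_ℓ` is a detector-recipe form, and «one edge, two coordinates» (R0) as a kernel identity:
# `Re 𝔅_θ(u(·/θ)) = F_θ(u)/θ`

Y. Zhang, *Discrete mean estimates and the Landau–Siegel zero*, arXiv:2211.02515v1 [Zhang2022LandauSiegel] —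
an unrefereed manuscript under adjudication. **WHAT THIS IS NOT: not a claim about Theorems 1–2 of
arXiv:2211.02515, about Landau–Siegel zeros, about Parity, or about a repaired `Margin232`; nothing analytic is
asserted.** «The programme SEARCHES and TYPES; no claim about Landau–Siegel zeros, Theorems 1–2 of
arXiv:2211.02515 or a repaired Margin232 until a kernel theorem says so.» (LANDAU–SIEGEL programme, rung F-S3,
cell `landau-siegel`, §D edge ell; typer ls-knife-typer-2.)

## What is proved (pure identities between objects already in the tree; no new `Prop` fact)

Three objects of record meet here:
* `mainTermFormEll ℓ` / `mainTermFormEllPolar ℓ` (`MainTermFormEll`, p429407; `MainTermFormEllPolar`): the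
  one-parameter deformation `F_ℓ = ℓ·[𝔅 with π ↦ πℓ]` of the main-term form — the knife edge `ℓ₀ = 1`
  (`mainTermFormEll_neg_of_one_lt`), lever L11 / E*-ℓ;
* `Det.FormDet R` / `Det.FormDetPolar R` / `Det.MformDet R` (`DetectorMainTermForm`, `DetectorRecipeMoments`):
  formula I of Prop. 7.1 with a free three-channel recipe `R = (W, b, s, n)`;
* `Repair.topDiagForm T` / `Repair.MformTop T` (`RepairLengthKnifeEdge`, `RepairTopFormIndefinite`, p430338):
  formula I continued to the free upper limit `T` — the knife edge `θ_max = 1`, lever L10 / E*-len.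

1. **`Det.ellRecipe ℓ := (W, ℓb, ℓs, ℓ²n)`** with the PRINTED weights `W = (½, 2, 3/2)` and the printed
   `(b, s, n) = ((1,2,3), (5,4,3), (6,3,2))` scaled by their homogeneity in the zero gap `α` (`β_j = ib_jα`,
   `s_j = b_{j+1}+b_{j+2}`, `n_j = b_{j+1}b_{j+2}`): `ellRecipe_one : ellRecipe 1 = zhangRecipe`; its shifts are the
   shift triple `ℓ·(1,2,3)` with `s = shiftS`, `n = shiftN` of that triple (`ellRecipe_s`, `ellRecipe_n`) — but its
   weights are the printed ones, NOT `Det.shiftW (ℓ·(1,2,3))` (the deformation `π ↦ πℓ` keeps `W`); channel moments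
   `(4, 15ℓ, 12ℓ², 9ℓ, 32ℓ², 24ℓ³)` (`ellRecipe_moments`).
2. **`F_ℓ` IS formula I with the recipe `ellRecipe ℓ`** on one-sided kinked profiles:
   `Det.formDetPolar_ellRecipe : FormDetPolar (ellRecipe ℓ) g g′ h h′ = mainTermFormEllPolar ℓ g g′ h h′`
   (`g(1) = h(1) = 0`; at `ℓ = 1` this is `Det.FormDetPolar_zhang`/the Gram identity `Repair.mainTermFormPolar_eq_Mform`),
   `Det.formDet_ellRecipe : FormDet (ellRecipe ℓ) g g′ = mainTermFormEll ℓ g g′`.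
3. **Dilation (change of variables, no regularity needed):** for `θ ≠ 0` and ANY `u, u′, v, v′`,
   `Repair.MformTop_dilate : M_θ(u(·/θ), v(·/θ)) = θ⁻¹ · MformDet (ellRecipe θ) u u′ v v′`
   (derivative slot `y ↦ θ⁻¹u′(y/θ)`; the substitution `y = θx` in `∫₀^θ` and in the tail `∫_y^θ`).
4. **R0 «one edge, two coordinates»** (FEASIBILITY.md v1.0b §0.5/§0.6 of the F-S2 cell, there a HEURISTIC float
   twin «θ·Q_θ(u(·/θ)) = F_θ(u) to 7·10⁻¹³ on 20 instances»; reduction key R0 of the §D critics, F-ℓ10 of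
   knife/ell/CRIT-2.md): `Repair.topDiagForm_dilate_re : Re 𝔅_θ(u(·/θ)) = F_θ(u)/θ` for every one-sided kinked `u`
   on `[0,1]` and `θ > 0` — the continued top form at length `θ` (E*-len currency) and the `ℓ`-form at `ℓ = θ`
   (E*-ℓ currency) are the same quadratic form up to dilation; so `Repair.topForm_indefinite` (𝔅_θ indefinite for
   θ > 1) and `mainTermFormEll_neg_of_one_lt`-type statements (F_ℓ not PSD for ℓ > 1) are one phenomenon read in two
   coordinates, and for `θ ≤ 1` … (nothing claimed: the PSD range is `RepairTopFormIndefinite`'s theorem).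
   Corollaries `Repair.topDiagForm_dilate_re_neg_iff` (`Re 𝔅_θ(u(·/θ)) < 0 ↔ F_θ(u) < 0`, `θ > 0`),
   `Repair.topDiagForm_re_eq_mainTermFormEll_rescale` (the same identity for a profile GIVEN on `[0,θ]`:
   `Re 𝔅_θ(g) = F_θ(g(θ·))/θ`), `Repair.topDiagForm_one_re` (`θ = 1`: `Re 𝔅_1(u) = 𝔅(u)`).

5. **A K₀ witness for the length knife edge (Part 5):** `Repair.mainTermFormEll_gCore : F_θ(g⋆) = 8π(1−θ)(9θ²−13θ+5)`
   for Zhang's kernel mode `g⋆ = k₁ + k₂` (`Objective.mainTermFormEll_afeComb`), hence by R0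
   `Repair.topDiagForm_dilate_gCore_re_neg : Re 𝔅_θ(g⋆(·/θ)) < 0` for every `θ > 1` — the kernel mode ITSELF,
   dilated `θ − 1` past `P`, is a witness of `topForm_indefinite`'s phenomenon.

6. **The PSD slot (Part 6):** `Det.formDetPSD_ellRecipe_one` (inside E*-S (ii) at `ℓ = 1`) and
   `Det.not_formDetPSD_ellRecipe : 1 < ℓ → ¬ Det.FormDetPSD (ellRecipe ℓ)` (witness `g⋆`, `Det.formDetNegWitness_ellRecipe`)
   — the knife edge `ℓ₀ = 1` in the detector-recipe coordinate of the barrier vocabulary (`RepairDetShift`).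

7. **Polar R0 (Part 7):** `Repair.topPolar_dilate` (`M_θ(u_θ,v_θ) + conj M_θ(v_θ,u_θ) = θ⁻¹·P_θ(u,v)`) and
   `Repair.jointCloses_dilate_iff` (the T-true shape `C₂₃₂·C₂₃₃ < |𝔡+𝔡′|²` at length `θ` on dilated profiles ↔
   the same shape for `(F_θ, P_θ)` on the unit profiles): R0 in the Cauchy–Schwarz currency.

8. **The sign box in the `ℓ`-coordinate (Part 8):** `Det.signAdmissible_ellRecipe_iff`
   (`SignAdmissible (ℓ,2ℓ,3ℓ) ↔ ℓ ∈ (0,1/3] ∪ [1/2,2/3] ∪ {1}`), `Det.not_signAdmissible_ellRecipe_of_one_lt`, and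
   `Det.exists_mainTermFormEll_afeDir_neg_of_not_signAdmissible` (outside the sign box `F_ℓ < 0` on `k₁` or `k₂`,
   `ℓ > 0` — the three windows of p429407 are exactly the complement of the sign set).

9. **The leaf `[1/2, 2/3]` is not a positivity region (Part 9):** `Det.mainTermFormEll_signLeaf_neg`
   (`F_ℓ(k₁ + (i/2)k₂) < 0` for `1/2 ≤ ℓ ≤ 2/3`, exact) and `Det.exists_neg_of_signLeaf` — the EXACT second lineage for
   ls-ref-1's float eigen-scan of 2026-08-26T20:26Z: «sign-admissible ⇒ F_ℓ ⪰ 0» fails on the middle leaf (witnesses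
   are wall-value profiles, `u(1) ≠ 0`).

10. **Positivity set (Part 10):** `Det.mainTermFormEll_exists_neg_of_third_lt` (`1/3 < ℓ`, `ℓ ≠ 1` ⇒ some `C¹` profile
   has `F_ℓ < 0`) and `Det.eq_one_of_mainTermFormEll_nonneg` (`F_ℓ ⪰ 0` on `C¹[0,1]` and `ℓ > 1/3` ⇒ `ℓ = 1`): the
   knife edge as the ONLY positivity point of `F_ℓ` beyond `1/3`.

Elementary calculus and algebra only (the atoms expansion `Det.MformDet_eq_moments`, the change of variables
`intervalIntegral.integral_comp_div`). Cited objects by name; no restatement; no `instance`, no `notation`.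

## References
* Y. Zhang, arXiv:2211.02515v1 (2022): §2 (2.10) (zero gap `α`), (2.13) (shifts `β_j = ijα(1 ∓ …)`), Prop. 7.1
  p. 44 with (7.2), §8 (8.11)–(8.23) pp. 44–50 (formula I). [cite: Zhang2022LandauSiegel, Prop 7.1, §8]
* Cell files (read-only provenance, not cited as mathematics): pub/zhang-knife/zhang-knife-ref/FEASIBILITY.md v1.0b
  2a4c608894c33a2e §0.5–§0.6 (R0); pub/landau-siegel/knife/ell/CRIT-2.md v0 (F-ℓ10); theory/KNIFE-EDGES.md §1–§2.
-/

noncomputable section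

open Complex Real ComplexConjugate Set intervalIntegral
open _root_.MeasureTheory

namespace Literature.NumberTheory.LFunctions.Zhang2022

namespace Det

open Repair

/-! ## Part 1 — the `ℓ`-recipe -/

/-- **The `ℓ`-recipe** `(W, ℓ·b, ℓ·s, ℓ²·n)`: the printed weights `W = (½, 2, 3/2)` and the printed channel
coefficients `b = (1,2,3)`, `s = (5,4,3)`, `n = (6,3,2)` scaled by their degree in the zero gap `α` of (2.10)
(`β_j = ib_jα`; `s_j`, `n_j` are the symmetric functions of the two complementary shifts) — the recipe whose
formula I is `F_ℓ = ℓ·[𝔅 with π ↦ πℓ]` (`formDet_ellRecipe`). A DEFINITION (a point of `DetRecipe`), not a claim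
that §§7–8 produce it in any regime. [cite: Zhang2022LandauSiegel, §2 (2.10), (2.13); Prop 7.1 p.44, (8.13)–(8.18)] -/
def ellRecipe (ℓ : ℝ) : DetRecipe where
  W := zhangRecipe.W
  b := fun j => ℓ * zhangRecipe.b j
  s := fun j => ℓ * zhangRecipe.s j
  n := fun j => ℓ ^ 2 * zhangRecipe.n j

/-- `ellRecipe 1` is the printed recipe. [cite: Zhang2022LandauSiegel, Prop 7.1 p.44, (8.13)–(8.18)] -/
theorem ellRecipe_one : ellRecipe 1 = zhangRecipe := by
  ext j <;> simp [ellRecipe]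

/-- The weights of the `ℓ`-recipe are the printed ones (the deformation `π ↦ πℓ` does not touch `W`).
[cite: Zhang2022LandauSiegel, Prop 7.1 p.44] -/
theorem ellRecipe_W (ℓ : ℝ) : (ellRecipe ℓ).W = zhangRecipe.W := rfl

/-- The shifts of the `ℓ`-recipe are the triple `ℓ·(1,2,3)`. [cite: Zhang2022LandauSiegel, §2 (2.13)] -/
theorem ellRecipe_b (ℓ : ℝ) : (ellRecipe ℓ).b = ![ℓ, 2 * ℓ, 3 * ℓ] := by
  funext j
  fin_cases j <;> simp [ellRecipe, zhangRecipe] <;> ring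

/-- `s = shiftS b` for the `ℓ`-recipe (complementary sums of the shift triple `ℓ·(1,2,3)`).
[cite: Zhang2022LandauSiegel, §8 (8.13)–(8.18)] -/
theorem ellRecipe_s (ℓ : ℝ) : (ellRecipe ℓ).s = shiftS (ellRecipe ℓ).b := by
  funext j
  fin_cases j <;> simp [ellRecipe, zhangRecipe, shiftS] <;> ring

/-- `n = shiftN b` for the `ℓ`-recipe (complementary products of the shift triple `ℓ·(1,2,3)`).
[cite: Zhang2022LandauSiegel, §8 (8.13)–(8.18)] -/
theorem ellRecipe_n (ℓ : ℝ) : (ellRecipe ℓ).n = shiftN (ellRecipe ℓ).b := by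
  funext j
  fin_cases j <;> simp [ellRecipe, zhangRecipe, shiftN] <;> ring

/-- **The six channel moments of the `ℓ`-recipe**: `(m₀, m_s, m_n, m_b, m_bs, m_bn) = (4, 15ℓ, 12ℓ², 9ℓ, 32ℓ², 24ℓ³)`
(at `ℓ = 1`: `Det.moments_zhang`). [cite: Zhang2022LandauSiegel, Prop 7.1 with (8.11)–(8.23), pp.44–50] -/
theorem ellRecipe_moments (ℓ : ℝ) :
    (∑ j : Fin 3, (ellRecipe ℓ).W j) = 4
      ∧ (∑ j : Fin 3, (ellRecipe ℓ).W j * ((ellRecipe ℓ).s j : ℂ)) = 15 * ℓ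
      ∧ (∑ j : Fin 3, (ellRecipe ℓ).W j * ((ellRecipe ℓ).n j : ℂ)) = 12 * (ℓ : ℂ) ^ 2
      ∧ (∑ j : Fin 3, (ellRecipe ℓ).W j * ((ellRecipe ℓ).b j : ℂ)) = 9 * ℓ
      ∧ (∑ j : Fin 3, (ellRecipe ℓ).W j * (((ellRecipe ℓ).b j : ℂ) * ((ellRecipe ℓ).s j : ℂ)))
          = 32 * (ℓ : ℂ) ^ 2
      ∧ (∑ j : Fin 3, (ellRecipe ℓ).W j * (((ellRecipe ℓ).b j : ℂ) * ((ellRecipe ℓ).n j : ℂ)))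
          = 24 * (ℓ : ℂ) ^ 3 := by
  simp only [ellRecipe, zhangRecipe, Fin.sum_univ_three, Matrix.cons_val_zero, Matrix.cons_val_one,
    Matrix.cons_val_two, Matrix.head_cons, Matrix.tail_cons]
  push_cast
  refine ⟨by norm_num, by ring, by ring, by ring, by ring, by ring⟩

/-! ## Part 2 — `F_ℓ` is formula I with the `ℓ`-recipe (one-sided kinked profiles) -/

/-- `conj ∫₀¹ u v̄ = ∫₀¹ v ū`. [cite: Zhang2022LandauSiegel, Prop 7.1 with (8.11)–(8.23), pp.44–50] -/
private theorem conj_integral_mul_conj (u v : ℝ → ℂ) :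
    conj (∫ x in (0:ℝ)..1, u x * conj (v x)) = ∫ x in (0:ℝ)..1, v x * conj (u x) := by
  have : conj (∫ x in (0:ℝ)..1, u x * conj (v x)) = ∫ x in (0:ℝ)..1, conj (u x * conj (v x)) := by
    simp only [intervalIntegral, map_sub, integral_conj]
  rw [this]
  refine intervalIntegral.integral_congr fun x _ => ?_
  simp only [map_mul, Complex.conj_conj]
  ring

variable {g g' h h' : ℝ → ℂ}

/-- **`P_{ellRecipe ℓ}(g,h) = P_ℓ(g,h)`**: on one-sided kinked profiles the polar form of formula I with the
`ℓ`-recipe IS the polar form `mainTermFormEllPolar ℓ` of `F_ℓ` (at `ℓ = 1`: `FormDetPolar_zhang`, the Gram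
identity). [cite: Zhang2022LandauSiegel, Prop 7.1 with (8.11)–(8.23), pp.44–50; §2 (2.10)] -/
theorem formDetPolar_ellRecipe (ℓ : ℝ) (hg : KinkedProfile g g') (hh : KinkedProfile h h')
    (hg1 : g 1 = 0) (hh1 : h 1 = 0) :
    FormDetPolar (ellRecipe ℓ) g g' h h' = mainTermFormEllPolar ℓ g g' h h' := by
  obtain ⟨m0, ms, mn, mb, mbs, mbn⟩ := ellRecipe_moments ℓ
  rw [FormDetPolar, MformDet_eq_moments hg hh hg1, MformDet_eq_moments hh hg hh1, m0, ms, mn, mb, mbs, mbn]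
  unfold mainTermFormEllPolar mainTermFormEllSesq
  rw [hg1, hh1]
  have hπ : (π : ℂ) ≠ 0 := by exact_mod_cast Real.pi_ne_zero
  have c1 := conj_integral_mul_conj h' g'
  have c2 := conj_integral_mul_conj h' g
  have c4 := conj_integral_mul_conj h g'
  have c5 := conj_integral_mul_conj h g
  simp only [map_add, map_sub, map_mul, map_pow, map_neg, Complex.conj_conj, Complex.conj_I,
    Complex.conj_ofReal, map_ofNat, map_zero, mul_zero, sub_zero, add_zero, c1, c2, c4, c5]
  push_cast
  field_simp
  ring

/-- **`𝔅_{ellRecipe ℓ}(g) = F_ℓ(g)`** on one-sided kinked profiles: the `ℓ`-form of record `mainTermFormEll ℓ`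
(p429407) IS formula I with the `ℓ`-recipe (at `ℓ = 1`: `FormDet_zhang`).
[cite: Zhang2022LandauSiegel, Prop 7.1 with (8.11)–(8.23), pp.44–50; §2 (2.10)] -/
theorem formDet_ellRecipe (ℓ : ℝ) (hg : KinkedProfile g g') (hg1 : g 1 = 0) :
    FormDet (ellRecipe ℓ) g g' = mainTermFormEll ℓ g g' := by
  rw [FormDet, formDetPolar_ellRecipe ℓ hg hg hg1 hg1, mainTermFormEllPolar_self, Complex.ofReal_re]

/-- `M_{ellRecipe ℓ}` scales linearly in the weights: the recipe `(W/θ, ℓb, ℓs, ℓ²n)` has formula I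
`θ⁻¹·M_{ellRecipe ℓ}` (bookkeeping for the dilation identity). [cite: Zhang2022LandauSiegel, Prop 7.1 p.44, (8.11)–(8.12)] -/
theorem MformDet_ellRecipe_divW (ℓ θ : ℝ) (u u' v v' : ℝ → ℂ) :
    MformDet ⟨fun j => zhangRecipe.W j / θ, (ellRecipe ℓ).b, (ellRecipe ℓ).s, (ellRecipe ℓ).n⟩ u u' v v'
      = ((θ⁻¹ : ℝ) : ℂ) * MformDet (ellRecipe ℓ) u u' v v' := by
  simp only [MformDet, ellRecipe, Fin.sum_univ_three]
  push_cast
  ring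

end Det

namespace Repair

open Det

/-! ## Part 3 — dilation: formula I with top `θ` on `u(·/θ)` is formula I with the `θ`-recipe on `u` -/

variable {θ : ℝ}

/-- The tail of a dilated profile: `∫_y^θ v(t/θ) dt = θ·∫_{y/θ}^1 v`. [cite: Zhang2022LandauSiegel, Prop 7.1 p.44, (7.2)] -/
theorem integral_tail_dilate (hθ : θ ≠ 0) (v : ℝ → ℂ) (y : ℝ) :
    (∫ t in y..θ, v (t / θ)) = (θ : ℂ) * ∫ s in (y / θ)..1, v s := by
  rw [intervalIntegral.integral_comp_div v hθ, div_self hθ, Complex.real_smul]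

/-- One channel of formula I with top `θ` on dilated profiles, pointwise: with `c = θ⁻¹`,
`dipoleIntegrandTop θ j (u(·/θ)) (c·u′(·/θ)) (v(·/θ)) (c·v′(·/θ)) (y)
 = c²·dipoleIntegrandDet (θj) (θ·bS j) (θ²·bN j) u u′ v v′ (y/θ)`. [cite: Zhang2022LandauSiegel, Prop 7.1, Lemmas 8.2/8.4] -/
theorem dipoleIntegrandTop_dilate (hθ : θ ≠ 0) (j : ℕ) (u u' v v' : ℝ → ℂ) (y : ℝ) :
    dipoleIntegrandTop θ j (fun t => u (t / θ)) (fun t => ((θ⁻¹ : ℝ) : ℂ) * u' (t / θ))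
        (fun t => v (t / θ)) (fun t => ((θ⁻¹ : ℝ) : ℂ) * v' (t / θ)) y
      = ((θ⁻¹ : ℝ) : ℂ) ^ 2 *
        dipoleIntegrandDet (θ * j) (θ * bS j) (θ ^ 2 * bN j) u u' v v' (y / θ) := by
  have hθ' : (θ : ℂ) ≠ 0 := by exact_mod_cast hθ
  unfold dipoleIntegrandTop dipoleIntegrandDet
  rw [integral_tail_dilate hθ v y]
  simp only [map_add, map_mul, map_pow, Complex.conj_ofReal, Complex.conj_I]
  push_cast
  field_simp

/-- One channel of formula I with top `θ`, integrated, on dilated profiles: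
`∫₀^θ dipoleIntegrandTop θ j … = θ⁻¹ ∫₀¹ dipoleIntegrandDet (θj) (θ·bS j) (θ²·bN j) u u′ v v′`
(substitution `y = θx`; no regularity needed). [cite: Zhang2022LandauSiegel, Prop 7.1, Lemmas 8.2/8.4] -/
theorem integral_dipoleIntegrandTop_dilate (hθ : θ ≠ 0) (j : ℕ) (u u' v v' : ℝ → ℂ) :
    (∫ y in (0:ℝ)..θ, dipoleIntegrandTop θ j (fun t => u (t / θ)) (fun t => ((θ⁻¹ : ℝ) : ℂ) * u' (t / θ))
        (fun t => v (t / θ)) (fun t => ((θ⁻¹ : ℝ) : ℂ) * v' (t / θ)) y)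
      = ((θ⁻¹ : ℝ) : ℂ) * ∫ x in (0:ℝ)..1, dipoleIntegrandDet (θ * j) (θ * bS j) (θ ^ 2 * bN j) u u' v v' x := by
  have hθ' : (θ : ℂ) ≠ 0 := by exact_mod_cast hθ
  simp_rw [dipoleIntegrandTop_dilate hθ]
  rw [intervalIntegral.integral_const_mul,
    intervalIntegral.integral_comp_div
      (fun x => dipoleIntegrandDet (θ * j) (θ * bS j) (θ ^ 2 * bN j) u u' v v' x) hθ,
    zero_div, div_self hθ, Complex.real_smul]
  push_cast
  field_simp

/-- **Dilation identity for formula I with a free top:** for `θ ≠ 0` and any `u, u′, v, v′`,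
`M_θ(u(·/θ), θ⁻¹u′(·/θ); v(·/θ), θ⁻¹v′(·/θ)) = θ⁻¹ · M_{ellRecipe θ}(u, u′; v, v′)` — the continued top-`θ`
form on profiles of logarithmic length `θ` is formula I with the `θ`-recipe on the unit interval.
[cite: Zhang2022LandauSiegel, Prop 7.1 p.44, (7.2), (8.11)–(8.12)] -/
theorem MformTop_dilate (hθ : θ ≠ 0) (u u' v v' : ℝ → ℂ) :
    MformTop θ (fun t => u (t / θ)) (fun t => ((θ⁻¹ : ℝ) : ℂ) * u' (t / θ))
        (fun t => v (t / θ)) (fun t => ((θ⁻¹ : ℝ) : ℂ) * v' (t / θ))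
      = ((θ⁻¹ : ℝ) : ℂ) * MformDet (ellRecipe θ) u u' v v' := by
  unfold MformTop
  rw [integral_dipoleIntegrandTop_dilate hθ 1, integral_dipoleIntegrandTop_dilate hθ 2,
    integral_dipoleIntegrandTop_dilate hθ 3]
  simp only [MformDet, ellRecipe, zhangRecipe, Fin.sum_univ_three, Matrix.cons_val_zero, Matrix.cons_val_one,
    Matrix.cons_val_two, Matrix.head_cons, Matrix.tail_cons, bS_one, bS_two, bS_three, bN_one, bN_two,
    bN_three]
  push_cast
  ring_nf

/-! ## Part 4 — R0 «one edge, two coordinates» -/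

variable {u u' : ℝ → ℂ}

/-- **R0 «one edge, two coordinates» (kernel form).** For a one-sided kinked profile `u` on `[0,1]`
(`u(1) = 0`) and `θ > 0`, the continued top form at length `θ` of the dilated profile `u(·/θ)` (derivative slot
`θ⁻¹u′(·/θ)`) is the `ℓ`-form at `ℓ = θ` divided by `θ`:
`Re 𝔅_θ(u(·/θ)) = F_θ(u)/θ` (`Repair.topDiagForm θ` vs `mainTermFormEll θ`). The length coordinate (E*-len,
`topForm_indefinite`, p430338) and the zero-spacing coordinate (E*-ℓ, `mainTermFormEll_neg_of_one_lt`, p429407)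
read ONE quadratic form. [cite: Zhang2022LandauSiegel, §2 (2.10), (2.13); Prop 7.1 p.44, (7.2), (8.11)–(8.23)] -/
theorem topDiagForm_dilate_re (hθ : 0 < θ) (hu : KinkedProfile u u') (hu1 : u 1 = 0) :
    (topDiagForm θ (fun t => u (t / θ)) (fun t => ((θ⁻¹ : ℝ) : ℂ) * u' (t / θ))).re
      = mainTermFormEll θ u u' / θ := by
  rw [topDiagForm_re, MformTop_dilate hθ.ne' u u' u u', ← formDet_ellRecipe θ hu hu1, formDet_eq_two_mul_re,
    Complex.mul_re, Complex.ofReal_re, Complex.ofReal_im]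
  simp only [zero_mul, sub_zero]
  rw [inv_eq_one_div]
  ring

/-- R0 read as a sign statement: for `θ > 0`, `Re 𝔅_θ(u(·/θ)) < 0 ↔ F_θ(u) < 0` (one-sided kinked `u`).
[cite: Zhang2022LandauSiegel, §2 (2.10); Prop 7.1 p.44, (7.2)] -/
theorem topDiagForm_dilate_re_neg_iff (hθ : 0 < θ) (hu : KinkedProfile u u') (hu1 : u 1 = 0) :
    (topDiagForm θ (fun t => u (t / θ)) (fun t => ((θ⁻¹ : ℝ) : ℂ) * u' (t / θ))).re < 0
      ↔ mainTermFormEll θ u u' < 0 := by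
  rw [topDiagForm_dilate_re hθ hu hu1, div_neg_iff]
  constructor
  · rintro (⟨_, h⟩ | ⟨h, _⟩)
    · exact absurd hθ (not_lt.2 h.le)
    · exact h
  · exact fun h => Or.inr ⟨h, hθ⟩

/-- R0 at `θ = 1`: no dilation, `Re 𝔅_1(u) = F_1(u) = 𝔅(u)` (one-sided kinked `u`; `mainTermFormEll_one`,
`MformTop_one`). [cite: Zhang2022LandauSiegel, Prop 7.1 p.44, (7.2)] -/
theorem topDiagForm_one_re (hu : KinkedProfile u u') (hu1 : u 1 = 0) :
    (topDiagForm 1 u u').re = mainTermForm u u' := by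
  have h := topDiagForm_dilate_re one_pos hu hu1
  simp only [div_one, inv_one, Complex.ofReal_one, one_mul, mainTermFormEll_one] at h
  exact h

/-- **R0 for a profile GIVEN at length `θ`.** For `θ > 0` and `g` on `[0,θ]` with `g(θ) = 0` whose unit
rescaling `x ↦ g(θx)` (derivative slot `x ↦ θ·g′(θx)`) is a kinked profile on `[0,1]`:
`Re 𝔅_θ(g) = F_θ(g(θ·))/θ` — the form a length-`θ` card computes (E*-len currency, `Repair.topDiagForm θ`) is the
`ℓ`-form at `ℓ = θ` of the rescaled profile (E*-ℓ currency). [cite: Zhang2022LandauSiegel, §2 (2.10); Prop 7.1 p.44, (7.2), (8.11)–(8.23)] -/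
theorem topDiagForm_re_eq_mainTermFormEll_rescale {g g' : ℝ → ℂ} (hθ : 0 < θ)
    (hu : KinkedProfile (fun x => g (θ * x)) (fun x => ((θ : ℝ) : ℂ) * g' (θ * x))) (hg : g θ = 0) :
    (topDiagForm θ g g').re
      = mainTermFormEll θ (fun x => g (θ * x)) (fun x => ((θ : ℝ) : ℂ) * g' (θ * x)) / θ := by
  have hθ0 : θ ≠ 0 := hθ.ne'
  have h1 : (fun x => g (θ * x)) 1 = 0 := by simpa using hg
  have key := topDiagForm_dilate_re hθ hu h1
  have e1 : (fun t => (fun x => g (θ * x)) (t / θ)) = g := by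
    funext t; simp only [mul_div_cancel₀ t hθ0]
  have e2 : (fun t => ((θ⁻¹ : ℝ) : ℂ) * (fun x => ((θ : ℝ) : ℂ) * g' (θ * x)) (t / θ)) = g' := by
    funext t
    have hθc : ((θ : ℝ) : ℂ) ≠ 0 := by exact_mod_cast hθ0
    simp only [mul_div_cancel₀ t hθ0]
    push_cast
    field_simp
  rw [e1, e2] at key
  exact key

/-! ## Part 5 — the kernel mode `g⋆ = k₁ + k₂`, dilated past `P`: a K₀ witness for the length knife edge -/

/-- **`F_θ(g⋆) = 8π(1−θ)(9θ²−13θ+5)`** for Zhang's kernel mode `g⋆ = e^{−iπy} + e^{−2iπy}` (`Repair.gCore`,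
`mainTermForm_gCore : 𝔅(g⋆) = 0`): the K₀ cubic of the cell's line of record (crit-2 K10, design 002 `k₁+k₂`:
`π(40 − 144ℓ + 176ℓ² − 72ℓ³)`), read off `Objective.mainTermFormEll_afeComb` (`ellFormQ θ 1 1 0`).
[cite: Zhang2022LandauSiegel, §2 (2.10), (2.13); Prop 7.1 p.44] -/
theorem mainTermFormEll_gCore (θ : ℝ) :
    mainTermFormEll θ gCore gCore' = 8 * π * (1 - θ) * (9 * θ ^ 2 - 13 * θ + 5) := by
  have h := Objective.mainTermFormEll_afeComb θ 1 1 0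
  have e1 : (fun y => (1:ℂ) * afeDir 1 y + 1 * afeDir 2 y + 0 * afeDir 3 y) = gCore := by
    funext y; rfl
  have e2 : (fun y => (1:ℂ) * afeDir' 1 y + 1 * afeDir' 2 y + 0 * afeDir' 3 y) = gCore' := by
    funext y; rfl
  rw [e1, e2] at h
  rw [h, Objective.ellFormQ]
  simp only [norm_one, one_pow, mul_one, map_one, map_zero, norm_zero, Complex.one_im, Complex.zero_im,
    mul_zero, sub_zero]
  ring

/-- `F_θ(g⋆) < 0` for every `θ > 1` (`9θ² − 13θ + 5 > 0` always). [cite: Zhang2022LandauSiegel, §2 (2.10), (2.13)] -/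
theorem mainTermFormEll_gCore_neg (hθ : 1 < θ) : mainTermFormEll θ gCore gCore' < 0 := by
  rw [mainTermFormEll_gCore]
  have h1 : 1 - θ < 0 := by linarith
  have h2 : 0 < 9 * θ ^ 2 - 13 * θ + 5 := by nlinarith [sq_nonneg (θ - 13 / 18)]
  have h3 : 0 < 8 * π := by positivity
  have : 8 * π * (1 - θ) * (9 * θ ^ 2 - 13 * θ + 5) = -(8 * π * (θ - 1) * (9 * θ ^ 2 - 13 * θ + 5)) := by
    ring
  rw [this, neg_lt_zero]
  have h1' : 0 < θ - 1 := by linarith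
  positivity

/-- **A K₀ witness for the length knife edge, via R0:** Zhang's own kernel mode `g⋆` dilated to logarithmic
length `θ` (`n ≤ P^θ`) has continued top form `Re 𝔅_θ(g⋆(·/θ)) = 8π(1−θ)(9θ²−13θ+5)/θ` — `= 0` at `θ = 1`
(`𝔅(g⋆) = 0`) and NEGATIVE for every `θ > 1` (`topDiagForm_dilate_gCore_re_neg`; compare the witness
`s·g⋆ + φ_θ` of `Repair.topForm_indefinite`). [cite: Zhang2022LandauSiegel, §2 (2.10); Prop 7.1 p.44, (7.2)] -/
theorem topDiagForm_dilate_gCore_re (hθ : 0 < θ) :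
    (topDiagForm θ (fun t => gCore (t / θ)) (fun t => ((θ⁻¹ : ℝ) : ℂ) * gCore' (t / θ))).re
      = 8 * π * (1 - θ) * (9 * θ ^ 2 - 13 * θ + 5) / θ := by
  rw [topDiagForm_dilate_re hθ kinkedProfile_gCore gCore_one, mainTermFormEll_gCore]

/-- For every `θ > 1`: `Re 𝔅_θ(g⋆(·/θ)) < 0`. [cite: Zhang2022LandauSiegel, §2 (2.10); Prop 7.1 p.44, (7.2)] -/
theorem topDiagForm_dilate_gCore_re_neg (hθ : 1 < θ) :
    (topDiagForm θ (fun t => gCore (t / θ)) (fun t => ((θ⁻¹ : ℝ) : ℂ) * gCore' (t / θ))).re < 0 :=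
  (topDiagForm_dilate_re_neg_iff (zero_lt_one.trans hθ) kinkedProfile_gCore gCore_one).2
    (mainTermFormEll_gCore_neg hθ)

/-! ## Part 7 — R0 in the Cauchy–Schwarz currency: the POLAR top form of two dilated profiles -/

/-- **Polar R0.** For one-sided kinked `u, v` on `[0,1]` and `θ > 0`, the polar (cross) top form of the dilated
profiles — the combination `M_θ(g,h) + conj M_θ(h,g)` the cell's joint-currency files use (`RepairRplusJoint`) —
is the polar `ℓ`-form at `ℓ = θ` divided by `θ`:
`M_θ(u(·/θ), v(·/θ)) + conj M_θ(v(·/θ), u(·/θ)) = θ⁻¹ · P_θ(u, v)` (`mainTermFormEllPolar θ`; derivative slots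
`θ⁻¹u′(·/θ)`, `θ⁻¹v′(·/θ)`). So a CS-currency statement at length `θ` (blocks `Re 𝔅_θ`, cross `M_θ + conj M_θ`)
and the `ℓ`-currency triple (`C232Ell/C233Ell/dSumEll`-type values of `F_θ`, `P_θ`) agree up to the common factor
`θ⁻¹`, which cancels in `C₂₃₂·C₂₃₃ < |𝔡+𝔡′|²`. [cite: Zhang2022LandauSiegel, §2 (2.10), (2.17)–(2.18); Prop 7.1 p.44, (7.2), (8.11)–(8.23)] -/
theorem topPolar_dilate (hθ : 0 < θ) {v v' : ℝ → ℂ} (hu : KinkedProfile u u') (hv : KinkedProfile v v')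
    (hu1 : u 1 = 0) (hv1 : v 1 = 0) :
    MformTop θ (fun t => u (t / θ)) (fun t => ((θ⁻¹ : ℝ) : ℂ) * u' (t / θ))
        (fun t => v (t / θ)) (fun t => ((θ⁻¹ : ℝ) : ℂ) * v' (t / θ))
      + conj (MformTop θ (fun t => v (t / θ)) (fun t => ((θ⁻¹ : ℝ) : ℂ) * v' (t / θ))
        (fun t => u (t / θ)) (fun t => ((θ⁻¹ : ℝ) : ℂ) * u' (t / θ)))
      = ((θ⁻¹ : ℝ) : ℂ) * mainTermFormEllPolar θ u u' v v' := by
  rw [MformTop_dilate hθ.ne' u u' v v', MformTop_dilate hθ.ne' v v' u u',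
    ← formDetPolar_ellRecipe θ hu hv hu1 hv1, FormDetPolar, map_mul, Complex.conj_ofReal]
  ring

/-- **The joint (T-true) inequality is dilation-invariant:** for one-sided kinked `u` (the `H`-side), `f` (the
probe) and `θ > 0`, the CS-currency closing shape at length `θ` on the dilated profiles,
`Re 𝔅_θ(u_θ)·Re 𝔅_θ(f_θ) < ‖M_θ(u_θ,f_θ) + conj M_θ(f_θ,u_θ)‖²`, holds iff the `ℓ`-currency shape
`F_θ(u)·F_θ(f) < ‖P_θ(u,f)‖²` holds. [cite: Zhang2022LandauSiegel, §2 (2.17)–(2.18), (2.32)–(2.33); Prop 7.1 p.44, (7.2)] -/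
theorem jointCloses_dilate_iff (hθ : 0 < θ) {f f' : ℝ → ℂ} (hu : KinkedProfile u u') (hf : KinkedProfile f f')
    (hu1 : u 1 = 0) (hf1 : f 1 = 0) :
    (topDiagForm θ (fun t => u (t / θ)) (fun t => ((θ⁻¹ : ℝ) : ℂ) * u' (t / θ))).re
        * (topDiagForm θ (fun t => f (t / θ)) (fun t => ((θ⁻¹ : ℝ) : ℂ) * f' (t / θ))).re
      < ‖MformTop θ (fun t => u (t / θ)) (fun t => ((θ⁻¹ : ℝ) : ℂ) * u' (t / θ))
            (fun t => f (t / θ)) (fun t => ((θ⁻¹ : ℝ) : ℂ) * f' (t / θ))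
          + conj (MformTop θ (fun t => f (t / θ)) (fun t => ((θ⁻¹ : ℝ) : ℂ) * f' (t / θ))
            (fun t => u (t / θ)) (fun t => ((θ⁻¹ : ℝ) : ℂ) * u' (t / θ)))‖ ^ 2
    ↔ mainTermFormEll θ u u' * mainTermFormEll θ f f' < ‖mainTermFormEllPolar θ u u' f f'‖ ^ 2 := by
  rw [topDiagForm_dilate_re hθ hu hu1, topDiagForm_dilate_re hθ hf hf1, topPolar_dilate hθ hu hf hu1 hf1,
    norm_mul, Complex.norm_real, Real.norm_eq_abs, abs_of_pos (inv_pos.2 hθ), mul_pow]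
  have hθ2 : 0 < θ⁻¹ ^ 2 := by positivity
  constructor
  · intro h
    have e : mainTermFormEll θ u u' / θ * (mainTermFormEll θ f f' / θ)
        = θ⁻¹ ^ 2 * (mainTermFormEll θ u u' * mainTermFormEll θ f f') := by
      field_simp
    rw [e] at h
    exact lt_of_mul_lt_mul_left h hθ2.le
  · intro h
    have e : mainTermFormEll θ u u' / θ * (mainTermFormEll θ f f' / θ)
        = θ⁻¹ ^ 2 * (mainTermFormEll θ u u' * mainTermFormEll θ f f') := by
      field_simp
    rw [e]
    exact mul_lt_mul_of_pos_left h hθ2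

end Repair

namespace Det

open Repair

/-! ## Part 6 — the `ℓ`-recipe and the PSD slot E*-S (ii) (`Det.FormDetPSD`): inside at `ℓ = 1`, outside for
every `ℓ > 1` -/

/-- At `ℓ = 1` the `ℓ`-recipe is in the PSD class (`formDetPSD_zhang`). [cite: Zhang2022LandauSiegel, Prop 7.1 with (8.11)–(8.23), pp.44–50] -/
theorem formDetPSD_ellRecipe_one : FormDetPSD (ellRecipe 1) := by
  rw [ellRecipe_one]; exact formDetPSD_zhang

/-- **For every `ℓ > 1` the `ℓ`-recipe has a negative witness** — Zhang's own kernel mode `g⋆ = k₁ + k₂`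
(`FormDet (ellRecipe ℓ) g⋆ = F_ℓ(g⋆) = 8π(1−ℓ)(9ℓ²−13ℓ+5) < 0`): the shape `Det.FormDetNegWitness` of the
B-det registry (E-010, second half), realised. [cite: Zhang2022LandauSiegel, §2 (2.10), (2.13); Prop 7.1 p.44, (7.2)] -/
theorem formDetNegWitness_ellRecipe {ℓ : ℝ} (hℓ : 1 < ℓ) : FormDetNegWitness (ellRecipe ℓ) :=
  ⟨gCore, gCore', kinkedProfile_gCore, gCore_one, by
    rw [formDet_ellRecipe ℓ kinkedProfile_gCore gCore_one]; exact mainTermFormEll_gCore_neg hℓ⟩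

/-- **… so the `ℓ`-recipe is OUTSIDE the PSD class for every `ℓ > 1`:** `¬ Det.FormDetPSD (ellRecipe ℓ)` — the
knife edge `ℓ₀ = 1` (p429407) read in the detector-recipe coordinate of the cell's barrier vocabulary (the slot
that `Repair.not_repairable_detShift` DISPLAYS is refuted here, so its Cauchy–Schwarz protection
`Det.not_closing_of_psd` is unavailable for `ℓ > 1`). [cite: Zhang2022LandauSiegel, §2 (2.10), (2.13); Prop 7.1 p.44, (7.2)] -/
theorem not_formDetPSD_ellRecipe {ℓ : ℝ} (hℓ : 1 < ℓ) : ¬ FormDetPSD (ellRecipe ℓ) :=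
  (not_formDetPSD_iff _).2 (formDetNegWitness_ellRecipe hℓ)

/-! ## Part 8 — the shifts of the `ℓ`-recipe and Lemma 2.3's sign box (`Det.SignAdmissible`): the `ℓ`-triple
`(ℓ, 2ℓ, 3ℓ)` is sign-admissible EXACTLY for `ℓ ∈ (0, 1/3] ∪ [1/2, 2/3] ∪ {1}`, and on each of the three
complementary windows `(1/3, 1/2)`, `(2/3, 1)`, `(1, ∞)` the tree already has a NEGATIVE value of `F_ℓ` on an AFE
direction — `F_ℓ` loses positivity precisely where the `ℓ`-scaled shifts leave the sign box -/

/-- **The sign box in the `ℓ`-coordinate.** `Det.SignAdmissible (ellRecipe ℓ).b` (the shape of the PROOF of Lemma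
2.3: first shift `≤ α`, the two upper shifts inside one gap `[kα, (k+1)α]` of the lattice of Prop. 2.2 (iii)) holds
iff `ℓ ∈ (0, 1/3] ∪ [1/2, 2/3] ∪ {1}` (`k = 0, 1, 2`). [cite: Zhang2022LandauSiegel, §2 Lemma 2.3 and its proof p.12, (2.13)] -/
theorem signAdmissible_ellRecipe_iff (ℓ : ℝ) :
    SignAdmissible (ellRecipe ℓ).b ↔
      (0 < ℓ ∧ ℓ ≤ 1 / 3) ∨ (1 / 2 ≤ ℓ ∧ ℓ ≤ 2 / 3) ∨ ℓ = 1 := by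
  rw [ellRecipe_b]
  simp only [SignAdmissible, Matrix.cons_val_zero, Matrix.cons_val_one, Matrix.cons_val_two, Matrix.head_cons,
    Matrix.tail_cons]
  constructor
  · rintro ⟨h0, -, -, h1, k, hk1, hk2⟩
    have hk : (k : ℝ) ≤ 2 := by linarith
    have hk' : k ≤ 2 := by exact_mod_cast hk
    interval_cases k
    · left; exact ⟨h0, by push_cast at hk2; linarith⟩
    · right; left; exact ⟨by push_cast at hk1; linarith, by push_cast at hk2; linarith⟩
    · right; right; push_cast at hk1; linarith
  · rintro (⟨h0, h1⟩ | ⟨h0, h1⟩ | rfl)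
    · exact ⟨h0, by linarith, by linarith, by linarith, 0, by push_cast; linarith, by push_cast; linarith⟩
    · exact ⟨by linarith, by linarith, by linarith, by linarith, 1, by push_cast; linarith, by push_cast; linarith⟩
    · exact ⟨by norm_num, by norm_num, by norm_num, by norm_num, 2, by norm_num, by norm_num⟩

/-- In particular the `ℓ`-triple is OUTSIDE the sign box for every `ℓ > 1` (`b₀ = ℓ > 1`: the first shift has
passed the first lattice zero; and `3ℓ − 2ℓ = ℓ > 1`: the upper pair no longer fits in one gap) — so
`Det.ellRecipe ℓ`-designs are outside `Repair.familyDetShift`'s class for `ℓ > 1`.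
[cite: Zhang2022LandauSiegel, §2 Lemma 2.3 and its proof p.12, (2.13)] -/
theorem not_signAdmissible_ellRecipe_of_one_lt {ℓ : ℝ} (hℓ : 1 < ℓ) : ¬ SignAdmissible (ellRecipe ℓ).b := by
  rw [signAdmissible_ellRecipe_iff]
  rintro (⟨-, h⟩ | ⟨-, h⟩ | h) <;> linarith

/-- **Outside the sign box, `F_ℓ` is negative on an AFE direction (every `ℓ > 0`; all three windows are tree
theorems of p429407):** `(1/3, 1/2)` and `(1, ∞)` — `k₁ = e^{−iπy}` (`mainTermFormEll_afeDir_one_neg_of_lt_half`,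
`mainTermFormEll_neg_of_one_lt`); `(2/3, 1)` — `k₂ = e^{−2iπy}` (`mainTermFormEll_afeDir_two_neg`). One direction
of the cell's model-consistency reading (B-AH / E-014: sign-admissible shifts ⇒ non-negative discrete weights ⇒
a PSD model form); the converse «`F_ℓ ⪰ 0` on the sign set» is a theorem only at `ℓ = 1` (`mainTermForm_nonneg`)
and is NOT claimed on `(0, 1/3] ∪ [1/2, 2/3]`. [cite: Zhang2022LandauSiegel, §2 (2.10), (2.13), Lemma 2.3] -/
theorem exists_mainTermFormEll_afeDir_neg_of_not_signAdmissible {ℓ : ℝ} (hℓ : 0 < ℓ)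
    (h : ¬ SignAdmissible (ellRecipe ℓ).b) :
    ∃ j : ℕ, j ≠ 0 ∧ mainTermFormEll ℓ (afeDir j) (afeDir' j) < 0 := by
  rw [signAdmissible_ellRecipe_iff] at h
  push Not at h
  obtain ⟨h1, h2, h3⟩ := h
  by_cases ha : ℓ < 1 / 2
  · exact ⟨1, one_ne_zero, mainTermFormEll_afeDir_one_neg_of_lt_half (lt_of_not_ge fun h' => (h1 hℓ).not_ge h')
      ha⟩
  · by_cases hb : ℓ < 1
    · refine ⟨2, two_ne_zero, mainTermFormEll_afeDir_two_neg ?_ hb⟩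
      exact lt_of_not_ge fun h' => (h2 (not_lt.1 ha)).not_ge h'
    · exact ⟨1, one_ne_zero, mainTermFormEll_neg_of_one_lt (lt_of_le_of_ne (not_lt.1 hb) (Ne.symm h3))⟩

/-! ## Part 9 — the sign-box leaf `[1/2, 2/3]` is NOT a positivity region of `F_ℓ` on `C¹[0,1]`: an exact
wall-value witness (second lineage, in the kernel, for ls-ref-1's float falsifier of 2026-08-26T20:26Z) -/

/-- **`F_ℓ(k₁ + (i/2)k₂) = (1−ℓ)·[8π(2ℓ−1)(3ℓ−1) + 2π(2−ℓ)(2−3ℓ) − 32(1−ℓ)(3ℓ−1)]`** — the `ℓ`-form on the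
kernel-plane profile `u = e^{−iπy} + (i/2)e^{−2iπy}` (a WALL-VALUE profile: `u(1) = −1 + i/2 ≠ 0`), read off
`Objective.mainTermFormEll_afeComb` (the cross term `−64(1−ℓ)²(1−3ℓ)·Im(x₁x̄₂)` with `Im(1·conj(i/2)) = −1/2`).
[cite: Zhang2022LandauSiegel, §2 (2.10), (2.13)] -/
theorem mainTermFormEll_k1_halfI_k2 (ℓ : ℝ) :
    mainTermFormEll ℓ (fun y => (1:ℂ) * afeDir 1 y + (I / 2) * afeDir 2 y + 0 * afeDir 3 y)
        (fun y => (1:ℂ) * afeDir' 1 y + (I / 2) * afeDir' 2 y + 0 * afeDir' 3 y)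
      = (1 - ℓ) * (8 * π * (2 * ℓ - 1) * (3 * ℓ - 1) + 2 * π * (2 - ℓ) * (2 - 3 * ℓ)
          - 32 * (1 - ℓ) * (3 * ℓ - 1)) := by
  rw [Objective.mainTermFormEll_afeComb, Objective.ellFormQ]
  have hI : ‖(I / 2 : ℂ)‖ = 1 / 2 := by simp
  simp only [norm_one, one_pow, mul_one, hI, map_zero, norm_zero, mul_zero, map_div₀, Complex.conj_I,
    map_ofNat, one_mul, Complex.div_im, Complex.neg_im, Complex.I_im, Complex.neg_re, Complex.I_re]
  norm_num
  ring

/-- **On the whole leaf `1/2 ≤ ℓ ≤ 2/3` of Lemma 2.3's sign box the `ℓ`-form is INDEFINITE on `C¹[0,1]`:**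
`F_ℓ(k₁ + (i/2)k₂) < 0` there (the bracket is `< 0`: its `π`-part `2π(27ℓ²−28ℓ+8)` is convex, the subtracted
`32(1−ℓ)(3ℓ−1)` concave, and the endpoint values are `1.5π − 8 < 0`, `8π/3 − 32/3 < 0`). EXACT second lineage
for ls-ref-1's float eigen-scan (min eig −1.47/−1.83/−2.42 at ℓ = 1/2, 7/12, 2/3; witness directions with
`u(1⁻) ≠ 0`): «sign box ⇒ `F_ℓ ⪰ 0`» FAILS on `[1/2, 2/3]` for wall-value profiles — the converse suggested (and
explicitly not claimed) in Part 8 is refuted; the structural reading of record is ls-ref-1's: below `ℓ = 1` every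
negative direction found has `u(1⁻) ≠ 0` (for one-sided profiles and `θ ≤ 1` positivity is the theorem
`Repair.topDiagForm_re_nonneg_of_le_one` / the scaling law). [cite: Zhang2022LandauSiegel, §2 (2.10), (2.13)] -/
theorem mainTermFormEll_signLeaf_neg {ℓ : ℝ} (h₁ : 1 / 2 ≤ ℓ) (h₂ : ℓ ≤ 2 / 3) :
    mainTermFormEll ℓ (fun y => (1:ℂ) * afeDir 1 y + (I / 2) * afeDir 2 y + 0 * afeDir 3 y)
        (fun y => (1:ℂ) * afeDir' 1 y + (I / 2) * afeDir' 2 y + 0 * afeDir' 3 y) < 0 := by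
  rw [mainTermFormEll_k1_halfI_k2]
  have hπ3 : π < 3.15 := Real.pi_lt_d2
  have hπ0 : 0 < π := Real.pi_pos
  have hl : 0 < 1 - ℓ := by linarith
  have hq : 0 < 27 * ℓ ^ 2 - 28 * ℓ + 8 := by nlinarith [sq_nonneg (ℓ - 14 / 27)]
  have hbr : 8 * π * (2 * ℓ - 1) * (3 * ℓ - 1) + 2 * π * (2 - ℓ) * (2 - 3 * ℓ)
      - 32 * (1 - ℓ) * (3 * ℓ - 1) < 0 := by
    have e : 8 * π * (2 * ℓ - 1) * (3 * ℓ - 1) + 2 * π * (2 - ℓ) * (2 - 3 * ℓ)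
        = 2 * π * (27 * ℓ ^ 2 - 28 * ℓ + 8) := by ring
    rw [e]
    have h1 : 2 * π * (27 * ℓ ^ 2 - 28 * ℓ + 8) < 2 * 3.15 * (27 * ℓ ^ 2 - 28 * ℓ + 8) := by
      have := mul_lt_mul_of_pos_right hπ3 hq
      linarith
    nlinarith [mul_nonneg (sub_nonneg.2 h₁) (sub_nonneg.2 h₂)]
  exact mul_neg_of_pos_of_neg hl hbr

/-- Hence, although `(ℓ, 2ℓ, 3ℓ)` is sign-admissible for `ℓ ∈ [1/2, 2/3]` (`signAdmissible_ellRecipe_iff`), `F_ℓ` has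
a negative `C¹` profile there: the sign box is NOT the positivity region of `F_ℓ` on all of `C¹[0,1]` (it is, on the
tested range, for the single-exponential DIAGONAL `F_ℓ(k_j)` only). [cite: Zhang2022LandauSiegel, §2 (2.10), (2.13), Lemma 2.3] -/
theorem exists_neg_of_signLeaf {ℓ : ℝ} (h₁ : 1 / 2 ≤ ℓ) (h₂ : ℓ ≤ 2 / 3) :
    SignAdmissible (ellRecipe ℓ).b ∧ ∃ g g' : ℝ → ℂ, IsC1OnUnitInterval g g' ∧ mainTermFormEll ℓ g g' < 0 :=
  ⟨(signAdmissible_ellRecipe_iff ℓ).2 (Or.inr (Or.inl ⟨h₁, h₂⟩)), _, _, isC1_afeSpan 1 (I / 2) 0,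
    mainTermFormEll_signLeaf_neg h₁ h₂⟩

/-! ## Part 10 — the positivity set of `F_ℓ` on `C¹[0,1]` beyond `ℓ = 1/3` is exactly `{1}` -/

/-- **For every `ℓ > 1/3` other than the physical point `ℓ = 1`, `F_ℓ` takes a negative value on some `C¹`
profile** — windows `(1/3, 1/2)` (`k₁`), `[1/2, 2/3]` (`k₁ + (i/2)k₂`, Part 9), `(2/3, 1)` (`k₂`), `(1, ∞)` (`k₁`);
at `ℓ = 1`, `F₁ = 𝔅 ⪰ 0` (`mainTermFormEll_one_nonneg`). The knife-edge sentence of KNIFE-EDGES §1 («`F_ℓ`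
INDEFINITE for every tested `ℓ ≠ 1`», certified at eleven rational `ℓ` in O15-CERT §5) as ONE theorem on
`(1/3, ∞) ∖ {1}`; nothing is claimed on `(0, 1/3]`. [cite: Zhang2022LandauSiegel, §2 (2.10), (2.13)] -/
theorem mainTermFormEll_exists_neg_of_third_lt {ℓ : ℝ} (h : 1 / 3 < ℓ) (h1 : ℓ ≠ 1) :
    ∃ g g' : ℝ → ℂ, IsC1OnUnitInterval g g' ∧ mainTermFormEll ℓ g g' < 0 := by
  by_cases ha : ℓ < 1 / 2
  · exact ⟨afeDir 1, afeDir' 1, isC1_afeDir 1, mainTermFormEll_afeDir_one_neg_of_lt_half h ha⟩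
  by_cases hb : ℓ ≤ 2 / 3
  · exact (exists_neg_of_signLeaf (not_lt.1 ha) hb).2
  by_cases hc : ℓ < 1
  · exact ⟨afeDir 2, afeDir' 2, isC1_afeDir 2, mainTermFormEll_afeDir_two_neg (lt_of_not_ge hb) hc⟩
  · exact ⟨afeDir 1, afeDir' 1, isC1_afeDir 1,
      mainTermFormEll_neg_of_one_lt (lt_of_le_of_ne (not_lt.1 hc) (Ne.symm h1))⟩

/-- Contrapositive reading: if `F_ℓ ⪰ 0` on all `C¹[0,1]` profiles and `ℓ > 1/3`, then `ℓ = 1`.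
[cite: Zhang2022LandauSiegel, §2 (2.10), (2.13)] -/
theorem eq_one_of_mainTermFormEll_nonneg {ℓ : ℝ} (h : 1 / 3 < ℓ)
    (hpsd : ∀ g g' : ℝ → ℂ, IsC1OnUnitInterval g g' → 0 ≤ mainTermFormEll ℓ g g') : ℓ = 1 := by
  by_contra h1
  obtain ⟨g, g', hg, hneg⟩ := mainTermFormEll_exists_neg_of_third_lt h h1
  exact absurd (hpsd g g' hg) (not_le.2 hneg)

end Det

end Literature.NumberTheory.LFunctions.Zhang2022

end
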